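/-
Copyright: statement-level skeleton of a published paper (lit-balaban cell, Phase-2 proof seat p10, gen 5). No proof claims
beyond what the kernel checks below.
-/
import Mathlib
import Literature.MathematicalPhysics.QuantumFieldTheory.BalabanImbrieJaffe1984to88.BIJ85FibreOffCentre
import Literature.MathematicalPhysics.QuantumFieldTheory.Balaban1983to89.B4StripCauchy

/-!
# `BalabanImbrieJaffe1984to88.BIJ85FibreCrossTerms` — T. Bałaban, J. Imbrie, A. Jaffe, *Renormalization of the Higgs model:
minimizers, propagators and the stability of mean field theory*, Commun. Math. Phys. **97** (1985) 299–329
[BalabanImbrieJaffe1985]: Sect. 7.1 p. 324 (7.1.23)–(7.1.24) — **the off-centre averaging sum and the cross-term bound for EVERY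
block size n = L^k** (even L included): `Σ_{l≠0} Π_{ρ≠μ}|v_ρ(p′+l)|²/Δ(p′+l) ≤ 33/4` uniformly in n over the complete residue system
of offsets k : Fin d → Fin n (all directions but μ damped by |v_ρ|², direction μ by 1/Δ, product structure + Σ_j|v(x+2πj)|² = 1),
whence `|A_ν(f^⊥)| ≤ (33/2)Σ_μ|f^⊥_{μν}|` and `Σ_ν|A_ν(f^⊥)|²/φ_ν ≤ C₅(d)²‖f^⊥‖²` for the (∂𝒦)^⊥ part of the (7.1.19) splitting —
the uniform control of the cross terms of (7.1.25)–(7.1.27) (print: *"‖τ₂(p)‖ ≤ dc₂² = M (7.1.24)"*) — file 3b of seat p10 gen 5's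
all-n chain (`BIJ85FibreDuality`/`BIJ85FibreDualBound` → `BIJ85FibreCurlIntertwine` → `BIJ85FibreOffCentre`/this → `BIJ85Thm711AllL`)

statement-level skeleton of published theorems with citation tags; proofs where landed; nothing here is a claim about
the Yang–Mills mass gap

PDF held: `paper:balaban1985-cmp97-bij-higgs-minimizers` (journal page = PDF page + 298).  Renders read as images: PDF pp.
24–27 (journal 322–325), `run/shared/lean/pub/pub-balaban/t4/b2b-balaban-t4-lit2/renders/bij1985/…-p024…p027-x2.png`.

CITATION HEADER (lean-in-tree rule).  Part of the lit-balaban TYPED SKELETON (HOME `run/shared/lean/pub/lit-balaban/`); WHAT IS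
REPRODUCED: the estimates (7.1.23)–(7.1.24) of SKELETON row **C1.Prop7.1.2** in the service of **C1.Thm7.1.1** for all n
(`HOME/lit-balaban-r15/ROWS-C1.md`, fold owner r15, referee ref-5).  THE PRINTED TEXT (p. 324 [PDF 26]): *"It follows that for
all μ, ν, k, p, |a_μ(p)/φ_ν(p)^{1/2}| ≤ c₂. (7.1.23) Here (7.1.23) is an extension of (7.1.20). We infer from (7.1.23) that
‖τ₂(p)‖ ≤ dc₂² = M, (7.1.24) where here we use the norm on 𝒦(p) given by the inner product ⟨ , ⟩."*  In the dual formulation of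
`BIJ85FibreDuality` the role of a_μ/‖τ₂‖ is played by the off-centre part of the multiplier one-form A_ν evaluated on the (∂𝒦)^⊥
component f^⊥ (whose CENTRAL contribution vanishes by co-closedness).  Leaves: pub-balaban's `B4StripCauchy.inv_norm_Sxi_shift_le`
(1/S_ξ(x+2πj) ≤ 2/(j+1)² + 2/(n−j)²), `sum_reflect_inv_sq`, `B5Prop11Leaves.sum_uFactorr_fin` (Σ_j|v(x+2πj)|² = 1), Mathlib
`hasSum_zeta_two`, and `BIJ85FibreOffCentre`.
WHAT IS KERNEL-CHECKED (zero `sorry`, standard axioms), every n ≥ 1, every torus, every unit momentum p′ = sOf q: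
`hMaj` + `sum_hMaj_le` (Σ_j h_n(j) ≤ 33/4), `inv_lapK_le_hMaj` (1/Δ(p′+l) ≤ h_n(l_μ/2π), l ≠ 0), **`offcentre_sum_le`**
(Σ_{l≠0}Π_{ρ≠μ}|v_ρ|²/Δ ≤ 33/4 via `Fintype.prod_sum`), `norm_coeff_le` (|u v_ν∂̄_μw̄_{μν}| ≤ 2Π_{ρ≠μ}|v_ρ|²), `AK_term_eq`,
**`norm_AK_offcentre_le`** (|A_ν(ψ)| ≤ (33/2)Σ_μ|ψ_{μν}| for antisymmetric ψ with co-closed central source), `cFiveSq`,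
**`sum_AK_sq_div_phiK_le`** (Σ_ν|A_ν(ψ)|²/φ_ν ≤ C₅(d)²Σ|ψ_{μν}|²).  NOT CLAIMED here: the assembly (file 4).  Unit
`lit-balaban-p10` (gen 5), HOME as above.
-/

namespace Literature.MathematicalPhysics.QuantumFieldTheory.BalabanImbrieJaffe1984to88.BIJ85FibreCrossTerms

open scoped BigOperators ComplexConjugate
open Complex Finset
open Literature.MathematicalPhysics.QuantumFieldTheory.Balaban1983to89
open Literature.MathematicalPhysics.QuantumFieldTheory.Balaban1983to89.B4Strip
open Literature.MathematicalPhysics.QuantumFieldTheory.Balaban1983to89.B4StripCauchy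
open Literature.MathematicalPhysics.QuantumFieldTheory.Balaban1983to89.B5Prop11Plancherel
open Literature.MathematicalPhysics.QuantumFieldTheory.Balaban1983to89.B5Prop11Fiber
open Literature.MathematicalPhysics.QuantumFieldTheory.Balaban1983to89.B5Prop11Leaves
open Literature.MathematicalPhysics.QuantumFieldTheory.Balaban1983to89.B5Block118
open Literature.MathematicalPhysics.QuantumFieldTheory.BalabanImbrieJaffe1984to88.BIJ85Eq7111EdgeAverage
open Literature.MathematicalPhysics.QuantumFieldTheory.BalabanImbrieJaffe1984to88.BIJ85Eq7112FibreEnergy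
open Literature.MathematicalPhysics.QuantumFieldTheory.BalabanImbrieJaffe1984to88.BIJ85FibreDuality
open Literature.MathematicalPhysics.QuantumFieldTheory.BalabanImbrieJaffe1984to88.BIJ85FibreCurlIntertwine
open Literature.MathematicalPhysics.QuantumFieldTheory.BalabanImbrieJaffe1984to88.BIJ85FibreOffCentre

noncomputable section

variable {d : ℕ} (n : ℕ) [NeZero n] (M : Fin d → ℕ) [hM : ∀ μ, NeZero (M μ)]

/-! ## §4 The off-centre averaging sum, uniformly in n, and the bound on A_ν(f^⊥) -/

/-- The one-coordinate majorant h_n(j) of 1/Δ(p′+l) along direction μ: 1/4 if l_μ = 0 (then Δ ≥ 4 from another coordinate),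
2/(j+1)² + 2/(n−j)² if l_μ = 2πj ≠ 0 (B4 leaf `inv_norm_Sxi_shift_le`). [cite: BalabanImbrieJaffe1985, (7.1.23) p.324] -/
def hMaj (n : ℕ) (j : Fin n) : ℝ :=
  if (j : ℕ) = 0 then 1 / 4 else 2 / (((j : ℕ) : ℝ) + 1) ^ 2 + 2 / ((n : ℝ) - (j : ℕ)) ^ 2

omit [NeZero n] hM in
/-- kernel: h_n(j) ≥ 0. [cite: BalabanImbrieJaffe1985, (7.1.23) p.324] -/
theorem hMaj_nonneg (j : Fin n) : 0 ≤ hMaj n j := by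
  unfold hMaj
  split_ifs
  · norm_num
  · positivity

omit [NeZero n] hM in
/-- kernel: Σ_{i<n} 1/(i+1)² ≤ 2 (ζ(2) = π²/6). [cite: BalabanImbrieJaffe1985, (7.1.23) p.324] -/
theorem sum_inv_sq_le_two : ∑ j : Fin n, 1 / ((((j : ℕ) : ℝ)) + 1) ^ 2 ≤ 2 := by
  rw [Fin.sum_univ_eq_sum_range (fun i => 1 / ((i : ℝ) + 1) ^ 2) n]
  have h1 : ∑ i ∈ Finset.range n, 1 / ((i : ℝ) + 1) ^ 2 = ∑ i ∈ Finset.range (n + 1), 1 / (i : ℝ) ^ 2 := by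
    rw [Finset.sum_range_succ']
    simp
  rw [h1]
  have h2 := sum_le_hasSum (Finset.range (n + 1)) (fun i _ => by positivity) hasSum_zeta_two
  have hπ := Real.pi_lt_d2
  have : Real.pi ^ 2 / 6 ≤ 2 := by nlinarith [Real.pi_pos]
  linarith

omit hM in
/-- **Σ_j h_n(j) ≤ 33/4**, uniformly in n. [cite: BalabanImbrieJaffe1985, (7.1.23) p.324] -/
theorem sum_hMaj_le : ∑ j : Fin n, hMaj n j ≤ 33 / 4 := by
  have hle : ∀ j : Fin n, hMaj n j ≤ 1 / 4 * (if (j : ℕ) = 0 then 1 else 0)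
      + (2 / ((((j : ℕ) : ℝ)) + 1) ^ 2 + 2 / ((n : ℝ) - (j : ℕ)) ^ 2) := by
    intro j
    have hjn : ((j : ℕ) : ℝ) + 1 ≤ n := by exact_mod_cast j.isLt
    have hpos : 0 ≤ 2 / ((((j : ℕ) : ℝ)) + 1) ^ 2 + 2 / ((n : ℝ) - (j : ℕ)) ^ 2 := by
      have : 0 < (n : ℝ) - (j : ℕ) := by linarith
      positivity
    unfold hMaj
    split_ifs
    · linarith
    · linarith
  have hcount : ∑ j : Fin n, (1 / 4 * (if (j : ℕ) = 0 then (1 : ℝ) else 0)) = 1 / 4 := by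
    rw [← Finset.mul_sum]
    have : ∑ j : Fin n, (if (j : ℕ) = 0 then (1 : ℝ) else 0) = 1 := by
      rw [Finset.sum_eq_single (0 : Fin n)]
      · simp
      · intro j _ hj
        exact if_neg (fun h => hj (Fin.ext (h.trans (Fin.val_zero n).symm)))
      · exact fun h => absurd (Finset.mem_univ _) h
    rw [this, mul_one]
  calc ∑ j : Fin n, hMaj n j
      ≤ ∑ j : Fin n, (1 / 4 * (if (j : ℕ) = 0 then (1 : ℝ) else 0)
          + (2 / ((((j : ℕ) : ℝ)) + 1) ^ 2 + 2 / ((n : ℝ) - (j : ℕ)) ^ 2)) := Finset.sum_le_sum fun j _ => hle j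
    _ = 1 / 4 + (2 * ∑ j : Fin n, 1 / ((((j : ℕ) : ℝ)) + 1) ^ 2 + 2 * ∑ j : Fin n, 1 / ((n : ℝ) - (j : ℕ)) ^ 2) := by
        rw [Finset.sum_add_distrib, hcount, Finset.sum_add_distrib, Finset.mul_sum, Finset.mul_sum]
        congr 1
        congr 1 <;> exact Finset.sum_congr rfl fun j _ => by ring
    _ ≤ 1 / 4 + (2 * 2 + 2 * 2) := by
        rw [sum_reflect_inv_sq]
        have := sum_inv_sq_le_two n
        linarith
    _ = 33 / 4 := by norm_num

/-- **1/Δ(p′+l) ≤ h_n(l_μ/2π) for l ≠ 0**: if l_μ = 0 use Δ ≥ 4; otherwise Δ(p′+l) ≥ |∂_μ(p′+l)|² = S_ξ(p′_μ + l_μ) and the B4 leaf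
1/S_ξ ≤ 2/(j+1)² + 2/(n−j)². [cite: BalabanImbrieJaffe1985, (7.1.23) p.324] -/
theorem inv_lapK_le_hMaj (q : Tor M) {k : Fin d → Fin n} (hk : k ≠ 0) (μ : Fin d) :
    1 / lapK n M q k ≤ hMaj n (k μ) := by
  have h4 := four_le_lapK n M q hk
  unfold hMaj
  split_ifs with hj
  · rw [div_le_div_iff₀ (by linarith) (by norm_num)]
    linarith
  · -- Δ ≥ |∂_μ(p′+l)|² = Sxir n (p′_μ + 2πk_μ)
    have hj1 : 1 ≤ (k μ : ℕ) := Nat.one_le_iff_ne_zero.mpr hj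
    have hjn : (k μ : ℕ) + 1 ≤ n := (k μ).isLt
    have hterm : ‖dSym n k (sOf M q) μ‖ ^ 2 ≤ lapK n M q k :=
      Finset.single_le_sum (f := fun ρ => ‖dSym n k (sOf M q) ρ‖ ^ 2) (fun _ _ => sq_nonneg _) (Finset.mem_univ μ)
    have hS : ‖dSym n k (sOf M q) μ‖ ^ 2 = ‖Sxi n ((sOf M q μ : ℂ) + 2 * Real.pi * ((k μ : ℕ) : ℂ))‖ := by
      rw [norm_dSym_sq, show ((sOf M q μ : ℂ) + 2 * Real.pi * ((k μ : ℕ) : ℂ)) = ((shiftr n k (sOf M q) μ : ℝ) : ℂ) by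
        simp only [shiftr]; push_cast; ring, Sxi_ofReal, Complex.norm_real, Real.norm_of_nonneg (Sxir_nonneg _ _)]
    have hinv := inv_norm_Sxi_shift_le n (k μ : ℕ) hj1 hjn (z := (sOf M q μ : ℂ)) (r := 0) (by norm_num)
      (by rw [Complex.ofReal_re, add_zero]; exact abs_sOf_le' M q μ)
    rw [← hS] at hinv
    have hpos : 0 < ‖dSym n k (sOf M q) μ‖ ^ 2 := by
      rw [hS]
      exact norm_pos_iff.mpr (Sxi_shift_ne_zero n (k μ : ℕ) hj1 hjn (r := 0) (by norm_num)
        (by rw [Complex.ofReal_re, add_zero]; exact abs_sOf_le' M q μ))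
    calc 1 / lapK n M q k ≤ 1 / ‖dSym n k (sOf M q) μ‖ ^ 2 := one_div_le_one_div_of_le hpos hterm
      _ ≤ _ := hinv

/-- **THE OFF-CENTRE AVERAGING SUM, uniformly in n**: Σ_{l≠0} Π_{ρ≠μ}|v_ρ(p′+l)|²/Δ(p′+l) ≤ 33/4 — the estimate behind (7.1.23)–(7.1.24)
(all directions but μ damped by |v_ρ|², direction μ by 1/Δ; product structure of the residue system and Σ_j|v(x+2πj)|² = 1).
[cite: BalabanImbrieJaffe1985, (7.1.23) p.324] -/
theorem offcentre_sum_le (q : Tor M) (μ : Fin d) :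
    ∑ k ∈ Finset.univ.erase (0 : Fin d → Fin n),
      (∏ ρ ∈ Finset.univ.erase μ, ‖vSym n k (sOf M q) ρ‖ ^ 2) / lapK n M q k ≤ 33 / 4 := by
  classical
  have hs := abs_sOf_le' M q
  -- the separable majorant F_ρ(j): h_n(j) in direction μ, |v|² = uFactorr in the others
  set F : Fin d → Fin n → ℝ := fun ρ j => if ρ = μ then hMaj n j else uFactorr n (j : ℕ) (sOf M q ρ) with hF
  have hFprod : ∀ k : Fin d → Fin n,
      ∏ ρ, F ρ (k ρ) = hMaj n (k μ) * ∏ ρ ∈ Finset.univ.erase μ, ‖vSym n k (sOf M q) ρ‖ ^ 2 := by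
    intro k
    rw [← Finset.mul_prod_erase _ _ (Finset.mem_univ μ)]
    congr 1
    · simp only [hF, if_true]
    · refine Finset.prod_congr rfl fun ρ hρ => ?_
      have hρμ : ρ ≠ μ := (Finset.mem_erase.mp hρ).1
      simp only [hF, if_neg hρμ]
      rw [norm_vSym_sq n NeZero.one_le k (sOf M q) ρ (hs ρ)]
  have hmaj : ∀ k ∈ Finset.univ.erase (0 : Fin d → Fin n),
      (∏ ρ ∈ Finset.univ.erase μ, ‖vSym n k (sOf M q) ρ‖ ^ 2) / lapK n M q k ≤ ∏ ρ, F ρ (k ρ) := by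
    intro k hk
    have hk0 : k ≠ 0 := (Finset.mem_erase.mp hk).1
    rw [hFprod, div_eq_mul_one_div, mul_comm]
    exact mul_le_mul_of_nonneg_right (inv_lapK_le_hMaj n M q hk0 μ) (Finset.prod_nonneg fun _ _ => sq_nonneg _)
  have hsumF : ∑ k : Fin d → Fin n, ∏ ρ, F ρ (k ρ) = ∑ j : Fin n, hMaj n j := by
    rw [← Fintype.prod_sum, ← Finset.mul_prod_erase _ _ (Finset.mem_univ μ)]
    have h1 : ∑ j : Fin n, F μ j = ∑ j : Fin n, hMaj n j := Finset.sum_congr rfl fun j _ => by simp only [hF, if_true]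
    have h2 : ∏ ρ ∈ Finset.univ.erase μ, ∑ j : Fin n, F ρ j = 1 := by
      refine Finset.prod_eq_one fun ρ hρ => ?_
      have hρμ : ρ ≠ μ := (Finset.mem_erase.mp hρ).1
      simp only [hF, if_neg hρμ]
      exact sum_uFactorr_fin n NeZero.one_le (sOf M q ρ) (hs ρ)
    rw [h1, h2, mul_one]
  calc ∑ k ∈ Finset.univ.erase (0 : Fin d → Fin n),
        (∏ ρ ∈ Finset.univ.erase μ, ‖vSym n k (sOf M q) ρ‖ ^ 2) / lapK n M q k
      ≤ ∑ k ∈ Finset.univ.erase (0 : Fin d → Fin n), ∏ ρ, F ρ (k ρ) := Finset.sum_le_sum hmaj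
    _ ≤ ∑ k : Fin d → Fin n, ∏ ρ, F ρ (k ρ) :=
        Finset.sum_le_sum_of_subset_of_nonneg (Finset.erase_subset _ _) fun k _ _ =>
          Finset.prod_nonneg fun ρ _ => by
            simp only [hF]
            split_ifs
            · exact hMaj_nonneg n _
            · exact uFactorr_nonneg _ _ _
    _ = ∑ j : Fin n, hMaj n j := hsumF
    _ ≤ 33 / 4 := sum_hMaj_le n

omit hM in
/-- **The modulus of the coefficient of φ_{μν} in the l-term of A_ν**: |u v_ν·∂̄_μ·w̄_{μν}|(p′+l) = |∂^{(1)}_μ(p′)|·Π_{ρ≠μ}|v_ρ(p′+l)|² ≤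
2Π_{ρ≠μ}|v_ρ(p′+l)|² (μ ≠ ν; |w_{μν}| = Π_{ρ∉{μ,ν}}|v_ρ|, v_μ∂_μ = ∂^{(1)}_μ, |v| ≤ 1, |∂^{(1)}| ≤ 2).
[cite: BalabanImbrieJaffe1985, (7.1.23) p.324] -/
theorem norm_coeff_le (q : Tor M) (k : Fin d → Fin n) {μ ν : Fin d} (hμν : μ ≠ ν) :
    ‖rK n M q k ν * conj (dSym n k (sOf M q) μ) * conj (edgeW n k (sOf M q) μ ν)‖
      ≤ 2 * ∏ ρ ∈ Finset.univ.erase μ, ‖vSym n k (sOf M q) ρ‖ ^ 2 := by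
  have hv1 : ∀ ρ, ‖vSym n k (sOf M q) ρ‖ ≤ 1 := fun ρ => norm_vSym_le_one n NeZero.one_le k (sOf M q) ρ
  have hv0 : ∀ ρ, 0 ≤ ‖vSym n k (sOf M q) ρ‖ := fun ρ => norm_nonneg _
  have hε : ‖vSym n k (sOf M q) μ‖ * ‖dSym n k (sOf M q) μ‖ ≤ 2 := by
    rw [← norm_mul, ← d1Sym_eq_vSym_mul n NeZero.one_le k (sOf M q) μ]
    exact norm_d1Sym_le_two (sOf M q) μ
  have hν : ν ∈ Finset.univ.erase μ := Finset.mem_erase.mpr ⟨Ne.symm hμν, Finset.mem_univ ν⟩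
  -- |u| = |v_μ||v_ν|Π'', |w| = Π'' with Π'' over ρ ∉ {μ,ν}
  set P : ℝ := ∏ ρ ∈ (Finset.univ.erase μ).erase ν, ‖vSym n k (sOf M q) ρ‖ with hP
  have hu : ‖uSym n k (sOf M q)‖ = ‖vSym n k (sOf M q) μ‖ * (‖vSym n k (sOf M q) ν‖ * P) := by
    rw [uSym, Complex.norm_prod, ← Finset.mul_prod_erase _ _ (Finset.mem_univ μ), ← Finset.mul_prod_erase _ _ hν]
  have hprod : ∏ ρ ∈ Finset.univ.erase μ, ‖vSym n k (sOf M q) ρ‖ ^ 2 = ‖vSym n k (sOf M q) ν‖ ^ 2 * P ^ 2 := by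
    rw [← Finset.mul_prod_erase _ _ hν, hP, ← Finset.prod_pow]
  rw [norm_mul, norm_mul, Complex.norm_conj, Complex.norm_conj, norm_edgeW n M k q hμν, rK, norm_mul, hu, hprod, ← hP]
  have hvν := hv1 ν
  have hvν0 := hv0 ν
  calc ‖vSym n k (sOf M q) μ‖ * (‖vSym n k (sOf M q) ν‖ * P) * ‖vSym n k (sOf M q) ν‖ * ‖dSym n k (sOf M q) μ‖ * P
      = (‖vSym n k (sOf M q) μ‖ * ‖dSym n k (sOf M q) μ‖) * (‖vSym n k (sOf M q) ν‖ ^ 2 * P ^ 2) := by ring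
    _ ≤ 2 * (‖vSym n k (sOf M q) ν‖ ^ 2 * P ^ 2) :=
        mul_le_mul_of_nonneg_right hε (mul_nonneg (sq_nonneg _) (sq_nonneg _))

omit hM in
/-- The l-term of A_ν(ψ) as an explicit linear form in ψ: u v_ν·D_l(ν)/Δ = Σ_μ (u v_ν·∂̄_μ·w̄_{μν}/Δ)(p′+l)·ψ_{μν}.
[cite: BalabanImbrieJaffe1985, (7.1.16) p.323] -/
theorem AK_term_eq (q : Tor M) (ψ : Fin d × Fin d → ℂ) (k : Fin d → Fin n) (ν : Fin d) :
    rK n M q k ν * divK n M q ψ k ν / (lapK n M q k : ℂ)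
      = ∑ μ, rK n M q k ν * conj (dSym n k (sOf M q) μ) * conj (edgeW n k (sOf M q) μ ν) / (lapK n M q k : ℂ) * ψ (μ, ν) := by
  rw [divK, Finset.mul_sum, Finset.sum_div]
  exact Finset.sum_congr rfl fun μ _ => by rw [srcK]; ring

/-- **The (∂𝒦)^⊥ part is seen by the multiplier only off the centre, with a uniform bound**: if ψ is antisymmetric and its central
source is co-closed (Σ_μ ∂̄_μ(p′)w̄_{μν}(p′)ψ_{μν} = 0 for all ν — the f^⊥ of (7.1.19)), then |A_ν(ψ)| ≤ (33/2)·Σ_μ|ψ_{μν}| for every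
ν, every n and every p′ — the uniform control of the cross terms, cf. (7.1.23)–(7.1.24) ‖τ₂(p)‖ ≤ M.
[cite: BalabanImbrieJaffe1985, (7.1.24) p.324] -/
theorem norm_AK_offcentre_le (q : Tor M) {ψ : Fin d × Fin d → ℂ} (hψ : ∀ μ ν, ψ (ν, μ) = -ψ (μ, ν))
    (h0 : ∀ ν, divK n M q ψ 0 ν = 0) (ν : Fin d) :
    ‖AK n M q ψ ν‖ ≤ 33 / 2 * ∑ μ, ‖ψ (μ, ν)‖ := by
  classical
  have hdiag : ψ (ν, ν) = 0 := by
    have := hψ ν ν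
    linear_combination (1 / 2 : ℂ) * this
  -- drop the central term, expand the others as linear forms in ψ
  have hsplit : AK n M q ψ ν = ∑ k ∈ Finset.univ.erase (0 : Fin d → Fin n),
      ∑ μ, rK n M q k ν * conj (dSym n k (sOf M q) μ) * conj (edgeW n k (sOf M q) μ ν) / (lapK n M q k : ℂ) * ψ (μ, ν) := by
    rw [AK, ← Finset.add_sum_erase _ _ (Finset.mem_univ (0 : Fin d → Fin n)), h0, mul_zero, zero_div, zero_add]
    exact Finset.sum_congr rfl fun k _ => AK_term_eq n M q ψ k ν
  -- the coefficient bound, summed over l ≠ 0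
  have hcoef : ∀ μ, ∑ k ∈ Finset.univ.erase (0 : Fin d → Fin n),
      ‖rK n M q k ν * conj (dSym n k (sOf M q) μ) * conj (edgeW n k (sOf M q) μ ν) / (lapK n M q k : ℂ)‖ * ‖ψ (μ, ν)‖
        ≤ 33 / 2 * ‖ψ (μ, ν)‖ := by
    intro μ
    by_cases hμν : μ = ν
    · rw [hμν, hdiag, norm_zero]
      simp
    · rw [← Finset.sum_mul]
      refine mul_le_mul_of_nonneg_right ?_ (norm_nonneg _)
      calc ∑ k ∈ Finset.univ.erase (0 : Fin d → Fin n),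
            ‖rK n M q k ν * conj (dSym n k (sOf M q) μ) * conj (edgeW n k (sOf M q) μ ν) / (lapK n M q k : ℂ)‖
          ≤ ∑ k ∈ Finset.univ.erase (0 : Fin d → Fin n),
              2 * ((∏ ρ ∈ Finset.univ.erase μ, ‖vSym n k (sOf M q) ρ‖ ^ 2) / lapK n M q k) := by
            refine Finset.sum_le_sum fun k hk => ?_
            rw [norm_div, Complex.norm_real, Real.norm_of_nonneg (lapK_nonneg n M q k), mul_div_assoc']
            exact div_le_div_of_nonneg_right (norm_coeff_le n M q k hμν) (lapK_nonneg n M q k)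
        _ = 2 * ∑ k ∈ Finset.univ.erase (0 : Fin d → Fin n),
              (∏ ρ ∈ Finset.univ.erase μ, ‖vSym n k (sOf M q) ρ‖ ^ 2) / lapK n M q k := by rw [Finset.mul_sum]
        _ ≤ 2 * (33 / 4) := mul_le_mul_of_nonneg_left (offcentre_sum_le n M q μ) (by norm_num)
        _ = 33 / 2 := by norm_num
  rw [hsplit, Finset.sum_comm, Finset.mul_sum]
  calc ‖∑ μ, ∑ k ∈ Finset.univ.erase (0 : Fin d → Fin n),
        rK n M q k ν * conj (dSym n k (sOf M q) μ) * conj (edgeW n k (sOf M q) μ ν) / (lapK n M q k : ℂ) * ψ (μ, ν)‖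
      ≤ ∑ μ, ‖∑ k ∈ Finset.univ.erase (0 : Fin d → Fin n),
          rK n M q k ν * conj (dSym n k (sOf M q) μ) * conj (edgeW n k (sOf M q) μ ν) / (lapK n M q k : ℂ) * ψ (μ, ν)‖ :=
        norm_sum_le _ _
    _ ≤ ∑ μ, ∑ k ∈ Finset.univ.erase (0 : Fin d → Fin n),
          ‖rK n M q k ν * conj (dSym n k (sOf M q) μ) * conj (edgeW n k (sOf M q) μ ν) / (lapK n M q k : ℂ)‖ * ‖ψ (μ, ν)‖ := by
        refine Finset.sum_le_sum fun μ _ => (norm_sum_le _ _).trans (Finset.sum_le_sum fun k _ => ?_)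
        rw [norm_mul]
    _ ≤ ∑ μ, 33 / 2 * ‖ψ (μ, ν)‖ := Finset.sum_le_sum fun μ _ => hcoef μ

omit [NeZero n] hM in
/-- The cross-term constant: C₅(d)² = (33/2)²·d/φ_min(d). [cite: BalabanImbrieJaffe1985, (7.1.24) p.324] -/
def cFiveSq (d : ℕ) : ℝ := (33 / 2) ^ 2 * d / phiMin d

omit [NeZero n] hM in
/-- C₅(d)² ≥ 0. [cite: BalabanImbrieJaffe1985, (7.1.24) p.324] -/
theorem cFiveSq_nonneg (hd : 0 < d) : 0 ≤ cFiveSq d := by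
  unfold cFiveSq
  have := phiMin_pos hd
  positivity

/-- **Σ_ν |A_ν(ψ)|²/φ_ν(p′) ≤ C₅(d)²·Σ_{μν}|ψ_{μν}|²** for the (∂𝒦)^⊥ part (ψ antisymmetric with co-closed central source, p′ ≠ 0):
(7.1.23)–(7.1.24) in the form the cross terms of (7.1.25)–(7.1.27) use. [cite: BalabanImbrieJaffe1985, (7.1.24) p.324] -/
theorem sum_AK_sq_div_phiK_le (hd : 0 < d) {q : Tor M} (hq : q ≠ 0) {ψ : Fin d × Fin d → ℂ}
    (hψ : ∀ μ ν, ψ (ν, μ) = -ψ (μ, ν)) (h0 : ∀ ν, divK n M q ψ 0 ν = 0) :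
    ∑ ν, ‖AK n M q ψ ν‖ ^ 2 / phiK n M q ν ≤ cFiveSq d * ∑ μ, ∑ ν, ‖ψ (μ, ν)‖ ^ 2 := by
  have hφ := phiMin_pos hd
  have hterm : ∀ ν, ‖AK n M q ψ ν‖ ^ 2 / phiK n M q ν ≤ cFiveSq d * ∑ μ, ‖ψ (μ, ν)‖ ^ 2 := by
    intro ν
    have hA := norm_AK_offcentre_le n M q hψ h0 ν
    have hA2 : ‖AK n M q ψ ν‖ ^ 2 ≤ (33 / 2) ^ 2 * (d * ∑ μ, ‖ψ (μ, ν)‖ ^ 2) := by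
      have hcs : (∑ μ, ‖ψ (μ, ν)‖) ^ 2 ≤ d * ∑ μ, ‖ψ (μ, ν)‖ ^ 2 := by
        have := sq_sum_le_card_mul_sum_sq (s := (Finset.univ : Finset (Fin d))) (f := fun μ => ‖ψ (μ, ν)‖)
        rwa [Finset.card_univ, Fintype.card_fin] at this
      calc ‖AK n M q ψ ν‖ ^ 2 ≤ (33 / 2 * ∑ μ, ‖ψ (μ, ν)‖) ^ 2 :=
            pow_le_pow_left₀ (norm_nonneg _) hA 2
        _ = (33 / 2) ^ 2 * (∑ μ, ‖ψ (μ, ν)‖) ^ 2 := by ring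
        _ ≤ (33 / 2) ^ 2 * (d * ∑ μ, ‖ψ (μ, ν)‖ ^ 2) := mul_le_mul_of_nonneg_left hcs (by positivity)
    have hφν := phiMin_le_phiK n M hd hq ν
    have hφν0 : 0 < phiK n M q ν := lt_of_lt_of_le hφ hφν
    calc ‖AK n M q ψ ν‖ ^ 2 / phiK n M q ν ≤ (33 / 2) ^ 2 * (d * ∑ μ, ‖ψ (μ, ν)‖ ^ 2) / phiMin d :=
          div_le_div₀ (by positivity) hA2 hφ hφν
      _ = cFiveSq d * ∑ μ, ‖ψ (μ, ν)‖ ^ 2 := by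
          unfold cFiveSq
          field_simp
  calc ∑ ν, ‖AK n M q ψ ν‖ ^ 2 / phiK n M q ν ≤ ∑ ν, cFiveSq d * ∑ μ, ‖ψ (μ, ν)‖ ^ 2 := Finset.sum_le_sum fun ν _ => hterm ν
    _ = cFiveSq d * ∑ μ, ∑ ν, ‖ψ (μ, ν)‖ ^ 2 := by rw [← Finset.mul_sum, Finset.sum_comm]

end

end Literature.MathematicalPhysics.QuantumFieldTheory.BalabanImbrieJaffe1984to88.BIJ85FibreCrossTerms
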